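import Summits.NavierStokesRegularity.NavierStokesRegularity.Theorems.ExtremiserTransienceKStarAttainedHalfSpaceComposition
import HarnessLib
import Summits.NavierStokesRegularity.NavierStokesRegularity.Theorems.SoloRefutePermana2026Step7

/-!
# Route `ExtremiserTransience`, support item `KStarAttained` (stmt-NavierStokesRegularity-24370):
# THE TOP-SPEED SET OF A SMOOTH ATTAINER OF `κ⋆` SURROUNDS THE ORIGIN — (3/4) scaling of the wide field: `‖D^k ψ_L‖ = O(L^{1-k})`, sup bounds, support volume

Part of a 4-file plate (≤ 400 lines each, `lint.statement-form`) prepared by cell seat `nsreg-p3 g21` from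
`HOME/ns-regularity-ideate-p3/round-26/Law26U.lean` (a08432649975ded6); the mathematics, mechanism and the main theorem
`halfSpaceFree_of_attained` are described in the module docstring of file (4/4) `ExtremiserTransienceKStarAttainedHalfSpaceMain`.
Intended landing by a PROVER seat: `--supports stmt-NavierStokesRegularity-24370 --as helper`, files in order 1→4.
-/

noncomputable section

open Set Filter Topology MeasureTheory Metric
open scoped InnerProductSpace RealInnerProductSpace ENNReal NNReal ContDiff
open Literature.Analysis.FluidPDE
open Summit.NavierStokesRegularity.NavierStokesRegularity.Theorems
open Summit.NavierStokesRegularity.NavierStokesRegularity.Theorems.DepletionLadder.KStar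

namespace Summit.NavierStokesRegularity.NavierStokesRegularity.Theorems

-- the problem directory repeats the summit name (`NavierStokesRegularity/NavierStokesRegularity`)
set_option linter.dupNamespace false

namespace DepletionLadder.KStar.HalfSpace

variable {v φ : E3 → E3}

/-! ## 5. SUPPLEMENT (same seat, 2026-08-28 ≈05Z): the residual estimate A′ is PROVED

Scaling `ψ_L = L'·Ψ₁(·/L')` (`L' = max L 1`) gives `‖D^k ψ_L‖_∞ ≤ S_k L'^{1-k}` (Mathlib: every `ContDiffBump` is one base
profile composed with a homothety; `iteratedFDeriv` of `f ∘ A`, `A` linear), hence `‖Dφ_L‖_∞, ‖curl φ_L‖_∞ ≤ K/L'` and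
`‖D curl φ_L‖_∞, ‖curl curl φ_L‖_∞ ≤ K/L'²`, all supported in `B̄_{2L'}` (`|B̄_{2L'}| = 8L'³|B̄₁|`).  Then
`|J₁| ≤ (2κ+κ²)K‖Dv‖₂²/L'` (pointwise `|ω| ≤ κ|Dv|`), `|a₁| = |∫⟪v, curl curl φ_L⟫| ≤ ε‖v‖₂² + 8K²|B̄₁|/(εL')` (the tree's
curl adjointness `integral_inner_curl_eq_integral_inner_curl` + Young), `|c₁| ≤ ε‖∇ω‖₂² + 24K²|B̄₁|/(εL')`; choosing
`ε = θ/(2(‖·‖₂²+1))` and `L` large closes `WideFieldEstimates`, so the LAW `topSpeedSurroundsOrigin_holds` is UNCONDITIONAL. -/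

/-- `L' = max L 1`. -/
def Lp (L : ℝ) : ℝ := max L 1

/-- Auxiliary (`Lp_pos`); see the module docstring. [folklore] -/
theorem Lp_pos (L : ℝ) : 0 < Lp L := lt_of_lt_of_le one_pos (le_max_right _ _)
/-- Auxiliary (`one_le_Lp`); see the module docstring. [folklore] -/
theorem one_le_Lp (L : ℝ) : 1 ≤ Lp L := le_max_right _ _
/-- Auxiliary (`le_Lp`); see the module docstring. [folklore] -/
theorem le_Lp (L : ℝ) : L ≤ Lp L := le_max_left _ _

/-- The potential `ψ_L (y) = χ_L(y) · ½ t × y` (so `φ_L = curl ψ_L`). -/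
def pot (t : E3) (L : ℝ) : E3 → E3 := fun y => (bumpL L) y • ((1 / 2 : ℝ) • crossCLM t y)

/-- The unit profile `Ψ₁ = ψ_1` (`χ₁ · ½ t × y`, supported in `B₂`). -/
def prof (t : E3) : E3 → E3 := pot t 1

/-- Auxiliary (`wideField_eq`); see the module docstring. [folklore] -/
theorem wideField_eq (t : E3) (L : ℝ) : wideField t L = curl (pot t L) := rfl

/-- `χ_L(x) = χ₁(x / L')` (Mathlib's bump is built from one base profile). -/
theorem bumpL_apply (L : ℝ) (x : E3) : (bumpL L) x = (bumpL 1) ((Lp L)⁻¹ • x) := by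
  rw [ContDiffBump.apply, ContDiffBump.apply]
  have hL : (0 : ℝ) < max L 1 := Lp_pos L
  have h1 : (bumpL L).rOut / (bumpL L).rIn = 2 := by
    show 2 * max L 1 / max L 1 = 2
    field_simp
  have h2 : (bumpL 1).rOut / (bumpL 1).rIn = 2 := by
    show 2 * max (1:ℝ) 1 / max 1 1 = 2
    rw [max_self]; norm_num
  have h3 : (bumpL 1).rIn = 1 := by show max (1:ℝ) 1 = 1; exact max_self _
  rw [h1, h2, h3, sub_zero, sub_zero, inv_one, one_smul]
  rfl

/-- **Scaling identity** `ψ_L (x) = L' · Ψ₁ (x / L')`. -/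
theorem pot_eq (t : E3) (L : ℝ) : pot t L = fun x => (Lp L) • prof t ((Lp L)⁻¹ • x) := by
  funext x
  have hL : Lp L ≠ 0 := (Lp_pos L).ne'
  simp only [pot, prof, bumpL_apply L x, map_smul, smul_smul]
  congr 1
  field_simp

/-- Auxiliary (`prof_contDiff`); see the module docstring. [folklore] -/
theorem prof_contDiff (t : E3) : ContDiff ℝ ∞ (prof t) :=
  (bumpL 1).contDiff.smul ((crossCLM t).contDiff.const_smul _)

/-- Auxiliary (`pot_contDiff`); see the module docstring. [folklore] -/
theorem pot_contDiff (t : E3) (L : ℝ) : ContDiff ℝ ∞ (pot t L) :=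
  (bumpL L).contDiff.smul ((crossCLM t).contDiff.const_smul _)

/-- Auxiliary (`prof_hasCompactSupport`); see the module docstring. [folklore] -/
theorem prof_hasCompactSupport (t : E3) : HasCompactSupport (prof t) :=
  (bumpL 1).hasCompactSupport.smul_right

/-- `supp ψ_L ⊆ B̄_{2L'}`. -/
theorem tsupport_pot_subset (t : E3) (L : ℝ) : tsupport (pot t L) ⊆ closedBall (0 : E3) (2 * Lp L) :=
  (tsupport_smul_subset_left _ _).trans (by rw [(bumpL L).tsupport_eq]; exact subset_rfl)

/-- `supp (curl u) ⊆ supp u` (closed supports). -/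
theorem tsupport_curl_subset (u : E3 → E3) : tsupport (curl u) ⊆ tsupport u :=
  closure_minimal (fun x hx => by
    by_contra h
    exact hx (curl_eq_zero_of_notMem_tsupport h)) (isClosed_tsupport u)

/-- **Uniform derivative bounds by scaling:** `‖D^k ψ_L (x)‖ ≤ S_k · L' · L'^{-k}`. -/
theorem norm_iteratedFDeriv_pot_le (t : E3) (k : ℕ) :
    ∃ S : ℝ, 0 ≤ S ∧ ∀ L x, ‖iteratedFDeriv ℝ k (pot t L) x‖ ≤ S * Lp L * ((Lp L)⁻¹) ^ k := by
  obtain ⟨S, hS⟩ := ((prof_contDiff t).continuous_iteratedFDeriv (m := k) (by exact_mod_cast le_top)).bounded_above_of_compact_support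
    ((prof_hasCompactSupport t).iteratedFDeriv k)
  have hS0 : 0 ≤ S := (norm_nonneg _).trans (hS 0)
  refine ⟨S, hS0, fun L x => ?_⟩
  set A : E3 →L[ℝ] E3 := (Lp L)⁻¹ • ContinuousLinearMap.id ℝ E3 with hA
  have hAn : ‖A‖ ≤ (Lp L)⁻¹ := by
    rw [hA, norm_smul, Real.norm_eq_abs, abs_of_pos (inv_pos.2 (Lp_pos L))]
    exact mul_le_of_le_one_right (inv_pos.2 (Lp_pos L)).le ContinuousLinearMap.norm_id_le
  have hfun : pot t L = fun x => (Lp L) • (prof t ∘ A) x := by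
    rw [pot_eq]; rfl
  rw [hfun, iteratedFDeriv_const_smul_apply' (((prof_contDiff t).comp A.contDiff).contDiffAt.of_le (by exact_mod_cast le_top)),
    norm_smul, Real.norm_eq_abs, abs_of_pos (Lp_pos L)]
  rw [A.iteratedFDeriv_comp_right (prof_contDiff t) x (by exact_mod_cast le_top)]
  calc Lp L * ‖(iteratedFDeriv ℝ k (prof t) (A x)).compContinuousLinearMap fun _ => A‖
      ≤ Lp L * (‖iteratedFDeriv ℝ k (prof t) (A x)‖ * ∏ _i : Fin k, ‖A‖) :=
        mul_le_mul_of_nonneg_left (ContinuousMultilinearMap.norm_compContinuousLinearMap_le _ _) (Lp_pos L).le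
    _ ≤ Lp L * (S * ((Lp L)⁻¹) ^ k) := by
        refine mul_le_mul_of_nonneg_left ?_ (Lp_pos L).le
        rw [Fin.prod_const]
        exact mul_le_mul (hS _) (pow_le_pow_left₀ (norm_nonneg _) hAn k) (by positivity) hS0
    _ = S * Lp L * ((Lp L)⁻¹) ^ k := by ring

/-- Auxiliary (`wideField_contDiff`); see the module docstring. [folklore] -/
theorem wideField_contDiff (t : E3) (L : ℝ) : ContDiff ℝ ∞ (wideField t L) :=
  Permana2026.contDiff_curl_top (pot_contDiff t L)

/-- `supp φ_L, supp curl φ_L, supp curl curl φ_L ⊆ B̄_{2L'}`. -/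
theorem tsupport_wideField_subset (t : E3) (L : ℝ) :
    tsupport (wideField t L) ⊆ closedBall (0 : E3) (2 * Lp L) :=
  (tsupport_curl_subset _).trans (tsupport_pot_subset t L)

/-- Auxiliary (`curl_curl_wideField_eq_zero`); see the module docstring. [folklore] -/
theorem curl_curl_wideField_eq_zero (t : E3) (L : ℝ) {x : E3} (hx : x ∉ closedBall (0 : E3) (2 * Lp L)) :
    curl (curl (wideField t L)) x = 0 :=
  curl_eq_zero_of_notMem_tsupport fun h => hx (((tsupport_curl_subset _).trans (tsupport_wideField_subset t L)) h)

/-- Auxiliary (`fderiv_curl_wideField_eq_zero`); see the module docstring. [folklore] -/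
theorem fderiv_curl_wideField_eq_zero (t : E3) (L : ℝ) {x : E3} (hx : x ∉ closedBall (0 : E3) (2 * Lp L)) :
    fderiv ℝ (curl (wideField t L)) x = 0 :=
  fderiv_of_notMem_tsupport ℝ fun h => hx (((tsupport_curl_subset _).trans (tsupport_wideField_subset t L)) h)

/-- **Sup bounds (first order):** `‖Dφ_L‖_∞, ‖curl φ_L‖_∞ ≤ K / L'`. -/
theorem wideField_bound_one (t : E3) : ∃ K : ℝ, 0 ≤ K ∧ ∀ L x,
    ‖fderiv ℝ (wideField t L) x‖ ≤ K / Lp L ∧ ‖curl (wideField t L) x‖ ≤ K / Lp L := by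
  obtain ⟨S, hS0, hS⟩ := norm_iteratedFDeriv_pot_le t 2
  set κ := ‖curlCLM‖ with hκ
  have hκ0 : 0 ≤ κ := by rw [hκ]; positivity
  refine ⟨(κ + κ ^ 2) * S, by positivity, fun L x => ?_⟩
  have hL := Lp_pos L
  have hD : ‖fderiv ℝ (wideField t L) x‖ ≤ κ * S / Lp L := by
    rw [← norm_iteratedFDeriv_one, wideField_eq]
    calc ‖iteratedFDeriv ℝ 1 (curl (pot t L)) x‖ ≤ κ * ‖iteratedFDeriv ℝ (1 + 1) (pot t L) x‖ :=
          norm_iteratedFDeriv_curl_le_opNorm_mul (pot_contDiff t L) 1 (by exact_mod_cast le_top) x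
      _ ≤ κ * (S * Lp L * ((Lp L)⁻¹) ^ 2) := mul_le_mul_of_nonneg_left (hS L x) hκ0
      _ = κ * S / Lp L := by field_simp
  have hk1 : 0 ≤ κ * S := by positivity
  have hk2 : 0 ≤ κ ^ 2 * S := by positivity
  have h1 : κ * S / Lp L ≤ (κ + κ ^ 2) * S / Lp L := by
    apply div_le_div_of_nonneg_right _ hL.le; nlinarith
  have h2 : κ * (κ * S / Lp L) ≤ (κ + κ ^ 2) * S / Lp L := by
    rw [show κ * (κ * S / Lp L) = κ ^ 2 * S / Lp L by ring]
    apply div_le_div_of_nonneg_right _ hL.le; nlinarith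
  exact ⟨hD.trans h1, ((norm_curl_le _ x).trans (mul_le_mul_of_nonneg_left hD hκ0)).trans h2⟩

/-- **Sup bounds (second order):** `‖D curl φ_L‖_∞, ‖curl curl φ_L‖_∞ ≤ K / L'²`. -/
theorem wideField_bound_two (t : E3) : ∃ K : ℝ, 0 ≤ K ∧ ∀ L x,
    ‖fderiv ℝ (curl (wideField t L)) x‖ ≤ K / Lp L ^ 2 ∧ ‖curl (curl (wideField t L)) x‖ ≤ K / Lp L ^ 2 := by
  obtain ⟨S, hS0, hS⟩ := norm_iteratedFDeriv_pot_le t 3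
  set κ := ‖curlCLM‖ with hκ
  have hκ0 : 0 ≤ κ := by rw [hκ]; positivity
  refine ⟨(κ ^ 2 + κ ^ 3) * S, by positivity, fun L x => ?_⟩
  have hL := Lp_pos L
  have hD : ‖fderiv ℝ (curl (wideField t L)) x‖ ≤ κ ^ 2 * S / Lp L ^ 2 := by
    rw [← norm_iteratedFDeriv_one, wideField_eq]
    calc ‖iteratedFDeriv ℝ 1 (curl (curl (pot t L))) x‖ ≤ κ * ‖iteratedFDeriv ℝ (1 + 1) (curl (pot t L)) x‖ :=
          norm_iteratedFDeriv_curl_le_opNorm_mul (Permana2026.contDiff_curl_top (pot_contDiff t L)) 1 (by exact_mod_cast le_top) x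
      _ ≤ κ * (κ * ‖iteratedFDeriv ℝ (2 + 1) (pot t L) x‖) := mul_le_mul_of_nonneg_left
          (norm_iteratedFDeriv_curl_le_opNorm_mul (pot_contDiff t L) 2 (by exact_mod_cast le_top) x) hκ0
      _ ≤ κ * (κ * (S * Lp L * ((Lp L)⁻¹) ^ 3)) :=
          mul_le_mul_of_nonneg_left (mul_le_mul_of_nonneg_left (hS L x) hκ0) hκ0
      _ = κ ^ 2 * S / Lp L ^ 2 := by field_simp
  have hk3 : 0 ≤ κ ^ 3 * S := by positivity
  have hk2 : 0 ≤ κ ^ 2 * S := by positivity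
  have h1 : κ ^ 2 * S / Lp L ^ 2 ≤ (κ ^ 2 + κ ^ 3) * S / Lp L ^ 2 := by
    apply div_le_div_of_nonneg_right _ (by positivity); nlinarith
  have h2 : κ * (κ ^ 2 * S / Lp L ^ 2) ≤ (κ ^ 2 + κ ^ 3) * S / Lp L ^ 2 := by
    rw [show κ * (κ ^ 2 * S / Lp L ^ 2) = κ ^ 3 * S / Lp L ^ 2 by ring]
    apply div_le_div_of_nonneg_right _ (by positivity); nlinarith
  exact ⟨hD.trans h1, ((norm_curl_le _ x).trans (mul_le_mul_of_nonneg_left hD hκ0)).trans h2⟩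

/-- `|B̄_r| = r³ |B̄₁|` in `ℝ³`. -/
theorem volumeReal_closedBall (r : ℝ) (hr : 0 ≤ r) :
    (volume : Measure E3).real (closedBall (0 : E3) r) = r ^ 3 * (volume : Measure E3).real (closedBall (0 : E3) 1) := by
  rw [measureReal_def, measureReal_def, Measure.addHaar_closedBall' volume (0 : E3) hr, ENNReal.toReal_mul,
    ENNReal.toReal_ofReal (by positivity)]
  simp

/-- `∫ 𝟙_{B̄_r} c = |B̄_r| c` and integrability. -/
theorem integrable_indicator_closedBall (r c : ℝ) :
    Integrable ((closedBall (0 : E3) r).indicator fun _ => c) (volume : Measure E3) :=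
  (integrableOn_const (measure_closedBall_lt_top).ne).integrable_indicator measurableSet_closedBall

/-- Young: `a b ≤ ε a² + b² / ε`. -/
theorem mul_le_eps (a b : ℝ) {ε : ℝ} (hε : 0 < ε) : a * b ≤ ε * a ^ 2 + b ^ 2 / ε := by
  rw [← sub_nonneg]
  have : ε * a ^ 2 + b ^ 2 / ε - a * b = (ε * a - b) ^ 2 / ε + a * b := by field_simp; ring
  have h2 : ε * a ^ 2 + b ^ 2 / ε - a * b = ((ε * a - b / 2 * 1) ^ 2 + 3 / 4 * b ^ 2) / ε := by field_simp; ring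
  rw [h2]; positivity

/-- Auxiliary (`hasCompactSupport_wideField`); see the module docstring. [folklore] -/
theorem hasCompactSupport_wideField (t : E3) (L : ℝ) : HasCompactSupport (wideField t L) :=
  hasCompactSupport_curl (bumpL L).hasCompactSupport.smul_right

end DepletionLadder.KStar.HalfSpace

end Summit.NavierStokesRegularity.NavierStokesRegularity.Theorems

end
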